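import Summits.Ventures.PercRepro.ProfilePointedCircuitClassesStarSevenFromSharpB
import Summits.Ventures.PercRepro.ProfilePointedCircuitClassesStarSharpAsmC

/-!
# PercRepro — (★) AT `(7, 4)` FROM THE SHARP STATEMENT, PART C — THE THEOREM
(p5, gen 56; `proofs/P5-GM1.md` §84 ADD 1)

`N = R ⊕ {b, b′}` satisfies the hypotheses of `StarNineSharp` (`seriesExt_hyps`: nine points, rank 5, coloop-free,
`{b, b′}` a series pair), and the Sharp inequality of `N` at `(e, f)` is (★)₇ at `(e, f)` on `R`:
`starSeven_of_seriesExt`.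
-/

open scoped Matroid

namespace PercRepro.Cogirth

open Finset ThmH Skew Shadow Profile

open Classical

variable {α : Type} [DecidableEq α]

section StarSevenD

variable {R : Matroid α} [R.Finite] {b b' : α}

/-- The standing hypotheses of `StarNineSharp` hold on `N = R ⊕ {b, b′}` when `R` is a coloop-free rank-4
matroid on seven points. -/
theorem seriesExt_hyps (h : Disjoint R.E {b, b'}) (hR4 : rk R (gr R) = 4)
    (hcf7 : ∀ x ∈ gr R, rk R ((gr R).erase x) = 4) (hbb' : b ≠ b') :
    rk (seriesExt R b b' h) (gr (seriesExt R b b' h)) = 5 ∧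
    (∀ x ∈ gr (seriesExt R b b' h), rk (seriesExt R b b' h) ((gr (seriesExt R b b' h)).erase x) = 5) ∧
    SeriesPair (seriesExt R b b' h) b b' := by
  obtain ⟨hb, hb'⟩ := notMem_gr_of_disjoint h
  have hbN : b ∈ gr (seriesExt R b b' h) := by rw [gr_seriesExt]; exact mem_union_right _ (mem_insert_self _ _)
  have hb'N : b' ∈ gr (seriesExt R b b' h) := by
    rw [gr_seriesExt]; exact mem_union_right _ (mem_insert_of_mem (mem_singleton_self _))
  have hRN : gr R ⊆ gr (seriesExt R b b' h) := by rw [gr_seriesExt]; exact subset_union_left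
  have hfull : rk (seriesExt R b b' h) (gr (seriesExt R b b' h)) = 5 := by
    rw [rk_seriesExt _ subset_rfl, rk_parallelPair_inter, inter_eq_right.2 hRN, hR4, if_pos (Or.inl hbN)]
  have hcf : ∀ x ∈ gr (seriesExt R b b' h), rk (seriesExt R b b' h) ((gr (seriesExt R b b' h)).erase x) = 5 := by
    intro x hx
    rw [rk_seriesExt _ (erase_subset _ _), rk_parallelPair_inter]
    by_cases hxR : x ∈ gr R
    · have h1 : (gr (seriesExt R b b' h)).erase x ∩ gr R = (gr R).erase x := by
        ext z; simp only [mem_inter, mem_erase]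
        constructor
        · rintro ⟨⟨hzx, -⟩, hzR⟩; exact ⟨hzx, hzR⟩
        · rintro ⟨hzx, hzR⟩; exact ⟨⟨hzx, hRN hzR⟩, hzR⟩
      have hxb : x ≠ b := fun h' => hb (h' ▸ hxR)
      rw [h1, hcf7 x hxR, if_pos (Or.inl (mem_erase.2 ⟨hxb.symm, hbN⟩))]
    · have h1 : (gr (seriesExt R b b' h)).erase x ∩ gr R = gr R := by
        apply inter_eq_right.2
        intro z hz
        exact mem_erase.2 ⟨fun h' => hxR (h' ▸ hz), hRN hz⟩
      rw [h1, hR4]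
      have hx' := hx
      rw [gr_seriesExt, mem_union] at hx'
      rcases hx' with h' | h'
      · exact absurd h' hxR
      · simp only [mem_insert, mem_singleton] at h'
        rcases h' with rfl | rfl
        · rw [if_pos (Or.inr (mem_erase.2 ⟨hbb'.symm, hb'N⟩))]
        · rw [if_pos (Or.inl (mem_erase.2 ⟨hbb', hbN⟩))]
  refine ⟨hfull, hcf, hbN, hb'N, hbb', ?_, ?_, ?_⟩
  · rw [hcf b hbN, hfull]
  · rw [hcf b' hb'N, hfull]
  · have h1 : ((gr (seriesExt R b b' h)).erase b).erase b' = gr R := by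
      ext z
      simp only [mem_erase]
      constructor
      · rintro ⟨hzb', hzb, hz⟩
        rw [gr_seriesExt, mem_union] at hz
        rcases hz with h' | h'
        · exact h'
        · simp only [mem_insert, mem_singleton] at h'
          rcases h' with rfl | rfl
          · exact absurd rfl hzb
          · exact absurd rfl hzb'
      · intro hz
        exact ⟨fun h' => hb' (h' ▸ hz), fun h' => hb (h' ▸ hz), hRN hz⟩
    rw [h1, rk_seriesExt _ hRN, rk_parallelPair_inter, inter_self, hR4, if_neg (by
      rintro (h' | h')
      · exact hb h'
      · exact hb' h'), hfull]

/-- **(★) AT `(7, 4)` FROM THE SHARP STATEMENT**: on a coloop-free rank-4 matroid `R` on seven points (with two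
spare points `b ≠ b′` outside it), `in_3(e) ≤ in_3(f) + thru_3({e, f})` for all `e ≠ f`. -/
theorem starSeven_of_seriesExt (h : Disjoint R.E {b, b'}) (hn7 : (gr R).card = 7) (hR4 : rk R (gr R) = 4)
    (hcf7 : ∀ x ∈ gr R, rk R ((gr R).erase x) = 4) (hbb' : b ≠ b') {e f : α} (he : e ∈ gr R) (hf : f ∈ gr R)
    (hef : e ≠ f) : inCount R 3 e ≤ inCount R 3 f + thruCount R 3 {e, f} := by
  obtain ⟨hb, hb'⟩ := notMem_gr_of_disjoint h
  obtain ⟨hfull, hcf, hser⟩ := seriesExt_hyps h hR4 hcf7 hbb'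
  have hRN : gr R ⊆ gr (seriesExt R b b' h) := by rw [gr_seriesExt]; exact subset_union_left
  have heb : e ≠ b := fun h' => hb (h' ▸ he)
  have heb' : e ≠ b' := fun h' => hb' (h' ▸ he)
  have hfb : f ≠ b := fun h' => hb (h' ▸ hf)
  have hfb' : f ≠ b' := fun h' => hb' (h' ▸ hf)
  have hS := starNineSharp_holds (α := α) (seriesExt R b b' h) (card_gr_seriesExt hn7 hbb') hfull hcf b b' e f hser
    (hRN he) (hRN hf) hef heb heb' hfb hfb'
  unfold inCount thruCount at hS ⊢
  have hbY : ∀ Y ∈ biIndepSets R 3, b ∉ Y := fun Y hY h' => hb ((mem_biIndepSets.1 hY).1 h')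
  have hb'Y : ∀ Y ∈ biIndepSets R 3, b' ∉ Y := fun Y hY h' => hb' ((mem_biIndepSets.1 hY).1 h')
  rw [card_filter_biIndepSets_seriesExt hn7 hbb' (fun W => e ∈ W),
    card_filter_biIndepSets_seriesExt hn7 hbb' (fun W => ({b', f} : Finset α) ⊆ W),
    card_filter_biIndepSets_seriesExt hn7 hbb' (fun W => ({b', e, f} : Finset α) ⊆ W),
    card_filter_biIndepSets_seriesExt hn7 hbb' (fun W => f ∈ W),
    card_filter_biIndepSets_seriesExt hn7 hbb' (fun W => ({e, f} : Finset α) ⊆ W),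
    card_filter_biIndepSets_seriesExt hn7 hbb' (fun W => ({b', e} : Finset α) ⊆ W)] at hS
  -- the twelve lifted predicates
  have e1 : (biIndepSets R 3).filter (fun Y => e ∈ insert b Y) = (biIndepSets R 3).filter (fun Y => e ∈ Y) :=
    filter_congr (fun Y _ => by rw [mem_insert]; exact ⟨fun h' => h'.resolve_left heb, Or.inr⟩)
  have e2 : (biIndepSets R 3).filter (fun Y => e ∈ insert b' Y) = (biIndepSets R 3).filter (fun Y => e ∈ Y) :=
    filter_congr (fun Y _ => by rw [mem_insert]; exact ⟨fun h' => h'.resolve_left heb', Or.inr⟩)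
  have f1 : (biIndepSets R 3).filter (fun Y => f ∈ insert b Y) = (biIndepSets R 3).filter (fun Y => f ∈ Y) :=
    filter_congr (fun Y _ => by rw [mem_insert]; exact ⟨fun h' => h'.resolve_left hfb, Or.inr⟩)
  have f2 : (biIndepSets R 3).filter (fun Y => f ∈ insert b' Y) = (biIndepSets R 3).filter (fun Y => f ∈ Y) :=
    filter_congr (fun Y _ => by rw [mem_insert]; exact ⟨fun h' => h'.resolve_left hfb', Or.inr⟩)
  have bf1 : (biIndepSets R 3).filter (fun Y => ({b', f} : Finset α) ⊆ insert b Y) = ∅ := by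
    rw [filter_eq_empty_iff]
    intro Y hY hsub
    have := hsub (mem_insert_self _ _)
    rcases mem_insert.1 this with h' | h'
    · exact hbb' h'.symm
    · exact hb'Y Y hY h'
  have bf2 : (biIndepSets R 3).filter (fun Y => ({b', f} : Finset α) ⊆ insert b' Y) =
      (biIndepSets R 3).filter (fun Y => f ∈ Y) :=
    filter_congr (fun Y _ => by
      simp only [insert_subset_iff, singleton_subset_iff, mem_insert]
      constructor
      · rintro ⟨-, h'⟩; exact h'.resolve_left hfb'
      · intro h'; exact ⟨Or.inl trivial, Or.inr h'⟩)
  have bef1 : (biIndepSets R 3).filter (fun Y => ({b', e, f} : Finset α) ⊆ insert b Y) = ∅ := by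
    rw [filter_eq_empty_iff]
    intro Y hY hsub
    have := hsub (mem_insert_self _ _)
    rcases mem_insert.1 this with h' | h'
    · exact hbb' h'.symm
    · exact hb'Y Y hY h'
  have bef2 : (biIndepSets R 3).filter (fun Y => ({b', e, f} : Finset α) ⊆ insert b' Y) =
      (biIndepSets R 3).filter (fun Y => ({e, f} : Finset α) ⊆ Y) :=
    filter_congr (fun Y _ => by
      simp only [insert_subset_iff, singleton_subset_iff, mem_insert]
      constructor
      · rintro ⟨-, h1, h2⟩; exact ⟨h1.resolve_left heb', h2.resolve_left hfb'⟩
      · rintro ⟨h1, h2⟩; exact ⟨Or.inl trivial, Or.inr h1, Or.inr h2⟩)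
  have ef1 : (biIndepSets R 3).filter (fun Y => ({e, f} : Finset α) ⊆ insert b Y) =
      (biIndepSets R 3).filter (fun Y => ({e, f} : Finset α) ⊆ Y) :=
    filter_congr (fun Y _ => by
      simp only [insert_subset_iff, singleton_subset_iff, mem_insert]
      constructor
      · rintro ⟨h1, h2⟩; exact ⟨h1.resolve_left heb, h2.resolve_left hfb⟩
      · rintro ⟨h1, h2⟩; exact ⟨Or.inr h1, Or.inr h2⟩)
  have ef2 : (biIndepSets R 3).filter (fun Y => ({e, f} : Finset α) ⊆ insert b' Y) =
      (biIndepSets R 3).filter (fun Y => ({e, f} : Finset α) ⊆ Y) :=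
    filter_congr (fun Y _ => by
      simp only [insert_subset_iff, singleton_subset_iff, mem_insert]
      constructor
      · rintro ⟨h1, h2⟩; exact ⟨h1.resolve_left heb', h2.resolve_left hfb'⟩
      · rintro ⟨h1, h2⟩; exact ⟨Or.inr h1, Or.inr h2⟩)
  have be1 : (biIndepSets R 3).filter (fun Y => ({b', e} : Finset α) ⊆ insert b Y) = ∅ := by
    rw [filter_eq_empty_iff]
    intro Y hY hsub
    have := hsub (mem_insert_self _ _)
    rcases mem_insert.1 this with h' | h'
    · exact hbb' h'.symm
    · exact hb'Y Y hY h'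
  have be2 : (biIndepSets R 3).filter (fun Y => ({b', e} : Finset α) ⊆ insert b' Y) =
      (biIndepSets R 3).filter (fun Y => e ∈ Y) :=
    filter_congr (fun Y _ => by
      simp only [insert_subset_iff, singleton_subset_iff, mem_insert]
      constructor
      · rintro ⟨-, h'⟩; exact h'.resolve_left heb'
      · intro h'; exact ⟨Or.inl trivial, Or.inr h'⟩)
  rw [e1, e2, bf1, bf2, bef1, bef2, f1, f2, ef1, ef2, be1, be2, card_empty] at hS
  omega

end StarSevenD




end PercRepro.Cogirth
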